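import Mathlib
import Summits.ResolutionOfSingularities.ResolutionOfSingularities.Theorems.FrobeniusClosingSteerRadicandChainRealisationTower
import Literature.AlgebraicGeometry.Resolution.ExcellentRingsEssFiniteType
import Literature.RingTheory.KrullDimension.AffineDimension
import HarnessLib

/-!
# Crux `Steer` (stmt-ResolutionOfSingularities-16345), chain W4.1, R2 σ_top line: **K(2) realisation layer,
# layer-1 conclusions** — locality, common fraction field, excellence and dimension of the realised members

OURS (campaign `res-hironaka`, rung L ★L-G4, slot W4.1; seat `res-L1-type-o8` = `res-D-pv-015`; SPLIT of
res-L0-w41-plan-1's ORDER 05:10:18Z, realisation half, agreed with the K(2) holder res-type-026 05:29:44Z).  Not a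
statement of the manuscript under review; AI review is weaker than expert review.

For the realised members `realR hθ m = φ m (S m[θ]/(θ^p − f m)) ⊆ K′` of `…RealisationTower`, the hypotheses of
`Literature.AlgebraicGeometry.Resolution.Lipman1978NoEternalNormalBranch` other than normality and the quadratic
transform law: `IsLocalRing (realR hθ m)` (cleaned multiplicity makes the radicand ring local,
`…RealisationBase`), the fraction field of `realR hθ 0` is `K′` (`exists_frac_of_realR_zero`: the members have the
common fraction field `L₀`), `IsExcellentRing (realR hθ 0)` (excellence ascends along finite-type extensions —
Matsumura §32 p. 260, PROVED in the tree as `IsExcellentRing.of_finiteType'`), hence Noetherian, and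
`ringKrullDim (realR hθ m) = ringKrullDim (S m)` (injective integral extensions preserve dimension, Matsumura Thm 9.4,
tree `Literature.RingTheory.KrullDimension.ringKrullDim_eq_of_isIntegral`).
[folklore] [cite: Matsumura1987, §32 p. 260; Thm 9.4]
-/

noncomputable section

-- `Summit.<S>.<S>.…` duplicates the summit name by design (single-problem summit).
set_option linter.dupNamespace false

open Polynomial IsLocalRing

namespace Summit.ResolutionOfSingularities.ResolutionOfSingularities.Theorems.SwitchingDichotomy

namespace RadicandChainRealisation

open Literature.AlgebraicGeometry.Resolution

universe u

section LayerOne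

variable (p : ℕ) {L : Type u} [Field L] (S : ℕ → Subring L) (f : ∀ m, S m)
variable [Fact (Irreducible (radPoly p S f))] (g : ∀ m, S m) (x : ∀ m, S (m + 1))
variable (hθ : ∀ m, theta p S f g x m ^ p = emb p S f m (f m))

/-! ## (3) Layer-1 conclusions: locality, fractions, excellence, dimension -/

omit [Fact (Irreducible (radPoly p S f))] in
/-- The radicand ring of `f m` is local (cleaned multiplicity: `f m ≡ h^p` modulo `𝔪^p ⊆ 𝔪`). [folklore] -/
theorem isLocalRing_adjoinRoot_member [hp : Fact p.Prime] [CharP L p] [∀ m, IsLocalRing (S m)] (m : ℕ)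
    (hmult : ∃ h : S m, f m - h ^ p ∈ maximalIdeal (S m) ^ p) :
    IsLocalRing (AdjoinRoot ((X : (S m)[X]) ^ p - C (f m))) := by
  obtain ⟨h, hh⟩ := hmult
  exact isLocalRing_adjoinRoot (f m) h (Ideal.pow_le_self hp.out.ne_zero hh)

/-- **`R m` is local.** [folklore] -/
theorem isLocalRing_realR [Fact p.Prime] [CharP L p] [∀ m, IsLocalRing (S m)] (m : ℕ) (hinj : Function.Injective (phi p S f g x hθ m))
    (hmult : ∃ h : S m, f m - h ^ p ∈ maximalIdeal (S m) ^ p) :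
    IsLocalRing (realR p S f g x hθ m) :=
  haveI := isLocalRing_adjoinRoot_member p S f m hmult
  (equivRealR p S f g x hθ m hinj).isLocalRing

/-- Every element of `K′` is a polynomial in `root` with coefficients from `L₀`, hence lies in any subfield
containing `of(L₀)` and `root`. [folklore] -/
theorem mem_subfield_of_forall (F : Subfield (AdjoinRoot (radPoly p S f)))
    (hof : ∀ z : baseField S, AdjoinRoot.of (radPoly p S f) z ∈ F) (hroot : AdjoinRoot.root (radPoly p S f) ∈ F)
    (z : AdjoinRoot (radPoly p S f)) : z ∈ F := by
  obtain ⟨P, rfl⟩ := AdjoinRoot.mk_surjective z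
  rw [← AdjoinRoot.aeval_eq, Polynomial.aeval_def, AdjoinRoot.algebraMap_eq, eval₂_eq_sum]
  exact Subfield.sum_mem _ fun n _ => F.mul_mem (hof _) (F.pow_mem hroot n)

/-- **The field of fractions of `R 0` is `K′`**: every element of `K′` is a quotient of two elements of `R 0`
(the members have the common fraction field `L₀`, generated by the fractions of `S 0`). [folklore] -/
theorem exists_frac_of_realR_zero
    (hfrac : ∀ n (s : S n), ∃ u v : S 0, (v : L) ≠ 0 ∧ (s : L) = (u : L) / (v : L))
    (z : AdjoinRoot (radPoly p S f)) :
    ∃ a ∈ realR p S f g x hθ 0, ∃ b ∈ realR p S f g x hθ 0, b ≠ 0 ∧ z = a / b := by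
  set F : Subfield (AdjoinRoot (radPoly p S f)) := Subfield.closure (realR p S f g x hθ 0 : Set _) with hF
  -- (i) `of (L₀) ⊆ F`
  have hof : ∀ w : baseField S, AdjoinRoot.of (radPoly p S f) w ∈ F := by
    -- the subfield `F' := of ⁻¹ F` of `L₀` contains every `toBase n s`
    have hmem : ∀ n (s : S n), toBase S n s ∈ F.comap (AdjoinRoot.of (radPoly p S f)) := by
      intro n s
      obtain ⟨u, v, hv, hs⟩ := hfrac n s
      have hsv : toBase S n s = toBase S 0 u / toBase S 0 v := by
        apply Subtype.ext; push_cast; simp only [coe_toBase]; exact hs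
      rw [hsv]
      refine div_mem ?_ ?_ <;>
        exact Subfield.mem_comap.mpr (Subfield.subset_closure (emb_mem_realR p S f g x hθ 0 _))
    -- hence `F'` pushed into `L` contains `⋃ S n`, so it is all of `L₀`
    have hle : baseField S ≤ (F.comap (AdjoinRoot.of (radPoly p S f))).map (baseField S).subtype := by
      refine Subfield.closure_le.mpr fun t ht => ?_
      obtain ⟨n, hn⟩ := Set.mem_iUnion.mp ht
      exact ⟨toBase S n ⟨t, hn⟩, hmem n ⟨t, hn⟩, rfl⟩
    intro w
    obtain ⟨w', hw', hww⟩ := hle w.2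
    have : w' = w := Subtype.ext hww
    rw [← this]
    exact hw'
  -- (ii) `root ∈ F`
  have hroot : AdjoinRoot.root (radPoly p S f) ∈ F :=
    Subfield.subset_closure (by simpa using theta_mem_realR p S f g x hθ 0)
  -- (iii) so `z ∈ F`, i.e. `z` is a fraction of elements of `R 0`
  have hz : z ∈ F := mem_subfield_of_forall p S f F hof hroot z
  obtain ⟨a, ha, b, hb, hab⟩ := (Subfield.mem_closure_iff).mp hz
  rw [Subring.closure_eq] at ha hb
  by_cases hb0 : b = 0
  · refine ⟨0, Subring.zero_mem _, 1, Subring.one_mem _, one_ne_zero, ?_⟩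
    rw [← hab, hb0, div_zero, zero_div]
  · exact ⟨a, ha, b, hb, hb0, hab.symm⟩

/-- **`R 0` is excellent**: it is of finite type over the excellent ring `S 0`, and excellence ascends along
finite-type extensions (Matsumura §32 p. 260 — PROVED in the tree, `IsExcellentRing.of_finiteType'`).
[cite: Matsumura1987, §32 p. 260] -/
theorem isExcellentRing_realR_zero (hinj : Function.Injective (phi p S f g x hθ 0))
    (hexc : IsExcellentRing (S 0)) : IsExcellentRing (realR p S f g x hθ 0) := by
  letI : Algebra (S 0) (realR p S f g x hθ 0) :=
    ((equivRealR p S f g x hθ 0 hinj).toRingHom.comp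
      (AdjoinRoot.of ((X : (S 0)[X]) ^ p - C (f 0)))).toAlgebra
  let ψ : AdjoinRoot ((X : (S 0)[X]) ^ p - C (f 0)) →ₐ[S 0] realR p S f g x hθ 0 :=
    { (equivRealR p S f g x hθ 0 hinj).toRingHom with
      commutes' := fun s => by
        simp only [RingHom.algebraMap_toAlgebra, AdjoinRoot.algebraMap_eq]
        rfl }
  haveI : Algebra.FiniteType (S 0) (realR p S f g x hθ 0) :=
    Algebra.FiniteType.of_surjective ψ (equivRealR p S f g x hθ 0 hinj).surjective
  exact hexc.of_finiteType'

/-- `R 0` is Noetherian (it is excellent). [folklore] -/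
theorem isNoetherianRing_realR_zero (hinj : Function.Injective (phi p S f g x hθ 0))
    (hexc : IsExcellentRing (S 0)) : IsNoetherianRing (realR p S f g x hθ 0) :=
  (isExcellentRing_realR_zero p S f g x hθ hinj hexc).isQuasiExcellentRing.isNoetherianRing

/-- **`dim R m = dim S m`**: the radicand ring is an injective integral extension of `S m` (Matsumura Thm 9.4),
and `R m ≅` it. [cite: Matsumura1987, Thm 9.4] -/
theorem ringKrullDim_realR [Fact p.Prime] (m : ℕ) (hinj : Function.Injective (phi p S f g x hθ m)) :
    ringKrullDim (realR p S f g x hθ m) = ringKrullDim (S m) := by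
  rw [← ringKrullDim_eq_of_ringEquiv (equivRealR p S f g x hθ m hinj)]
  haveI := isIntegral_adjoinRoot (p := p) (f m)
  refine (Literature.RingTheory.KrullDimension.ringKrullDim_eq_of_isIntegral (R := S m)
    (S := AdjoinRoot ((X : (S m)[X]) ^ p - C (f m))) ?_).symm
  rw [AdjoinRoot.algebraMap_eq]
  exact of_injective (f m)

end LayerOne

end RadicandChainRealisation

end Summit.ResolutionOfSingularities.ResolutionOfSingularities.Theorems.SwitchingDichotomy

end
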